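import Literature.AlgebraicGeometry.PlaneCurves.HessePencilHessian
import HarnessLib

/-!
# The eight cubics `B₁, …, B₈` of the Hesse configuration (Artebani–Dolgachev, Prop. 5.2)

Topic `Literature/AlgebraicGeometry/PlaneCurves`, namespace `Literature.AlgebraicGeometry.PlaneCurves`.
Lane `lit-hodgefound`, seat `lit-hodgefound-p37`, row g19-#3; a one-file sequel of
`HessePencilHessian` (Q2201: `He(H_μ)`), `HessePencilTriangles` (Q2242: the four triangles
`E_∞ = XYZ`, `E_{−3} = H_1`, `E_{−3ε} = H_ε`, `E_{−3ε²} = H_{ε²}` and their vertices) and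
`HessePencilHessianGroup` (g18-#5: `g₀, …, g₄`).  Everything here is PROVED (polynomial
identities); no definition, no named fact.

Source followed — M. Artebani, I. Dolgachev, *The Hesse pencil of plane cubic curves*,
L'Enseignement Math. (2) 55 (2009) 235–273, §5, Proposition 5.2 [arXiv:math/0611590, held
`paper:arxiv-math_0611590` p0010 L45–L62], VERBATIM:

> **Proposition 5.2.** The curves `Bᵢ = p⁻¹(β(α(Eᵢ)))`, `i = 1, …, 8`, are plane cubic curves
> with equations
> `B₁ : x³ + εy³ + ε²z³ = 0`,          `B₅ : x³ + ε²y³ + εz³ = 0`,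
> `B₂ : x²y + y²z + z²x = 0`,          `B₆ : x²z + y²x + z²y = 0`,
> `B₃ : x²y + ε²y²z + εz²x = 0`,       `B₇ : x²z + εy²x + ε²z²y = 0`,
> `B₄ : x²y + εy²z + ε²z²x = 0`,       `B₈ : x²z + ε²y²x + εz²y = 0`.
> The union of the eight cubics `Bᵢ` cuts out on each nonsingular member of the Hesse pencil the
> set of points of order `9` in the group law with the point `p₀` as the origin. Each of them has
> one of the triangles of the Hesse pencil as inflection triangle and it is inscribed and
> circumscribed to the other three triangles (i.e. is tangent to one side of the triangle at each
> vertex).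

(§5 before it: "The action of the group `Γ` on `ℙ²` lifts to an action on `S(3)`" — `Γ = ⟨g₁, g₂⟩`,
`g₁(x, y, z) = (y, z, x)`, `g₂(x, y, z) = (x, εy, ε²z)`, and `p : ℙ² → ℙ²/Γ` is the quotient map,
so each `Bᵢ = p⁻¹(…)` is a `Γ`-invariant curve.)

## Dictionary

* `ε` is an `ω ∈ K` with `ω² + ω + 1 = 0`; `H_μ = X³ + Y³ + Z³ − 3μXYZ` (`𝐇[μ]`), so the four
  triangles are `XYZ` and `𝐇[1], 𝐇[ω], 𝐇[ω²]`, with sides (Q2242 `hesse_eq_prod_of_pow_three_eq_one`)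
  `𝐇[1] = (X+Y+Z)(X+ωY+ω²Z)(X+ω²Y+ωZ)`, `𝐇[ω] = (X+Y+ωZ)(X+ωY+Z)(X+ω²Y+ω²Z)`,
  `𝐇[ω²] = (X+Y+ω²Z)(X+ωY+ωZ)(X+ω²Y+Z)`, and vertices `(1,0,0),(0,1,0),(0,0,1)`;
  `(1,1,1),(1,ω,ω²),(1,ω²,ω)`; `(ω²,1,1),(1,ω²,1),(1,1,ω²)`; `(ω,1,1),(1,ω,1),(1,1,ω)` respectively
  (`hesse_omega_vertices`).
* "inflection triangle of `B`": the Hessian `He(B) = det(∂²B/∂Xᵢ∂Xⱼ)` IS (a non-zero multiple of)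
  that triangle, so the flexes `B ∩ He(B)` of `B` are its intersections with the three sides.
* "tangent to the side `L` at the vertex `v`": `B(v) = 0`, `L(v) = 0` and `∇B(v) = c·∇L`, `c ≠ 0`
  (written with explicit `c`).

## What is here (`K` a field)

* §1 **The inflection triangles** (any field; `ω² + ω + 1 = 0` where `ε` occurs):
  `det_hessianMatrix_cubic_xxy` — `He(X²Y + aY²Z + bZ²X) = 8(3abXYZ − bX³ − a²Y³ − ab²Z³)` and
  `det_hessianMatrix_cubic_xxz` — `He(X²Z + aZ²Y + bY²X) = 8(3abXYZ − bX³ − ab²Y³ − a²Z³)`; hence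
  `det_hessianMatrix_B₂`/`_B₆` (`= −8·𝐇[1]`: inflection triangle `E_{−3}`), `det_hessianMatrix_B₃`/`_B₇`
  (`= −8ω·𝐇[ω²]`), `det_hessianMatrix_B₄`/`_B₈` (`= −8ω²·𝐇[ω]`), and `det_hessianMatrix_B₁`/`_B₅`
  (`He(X³ + aY³ + bZ³) = 216ab·XYZ`: inflection triangle `E_∞`).
* §2 **`Γ`-invariance and the Hessian group**: `B₁_bind₁_g₁` (`B₁ ∘ g₁ = ω²B₁`), `B₁_bind₁_g₂`
  (`= B₁`), `B₂_bind₁_g₁` (`= B₂`), `B₂_bind₁_g₂` (`= ωB₂`); `B₂_bind₁_g₄` (`B₂ ∘ g₄ = ωB₃`),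
  `B₂_bind₁_g₄_sq` (`B₂ ∘ g₄² = ω²B₄`), `B_bind₁_g₀` (`B₁ ∘ g₀ = B₅`, `B₂ ∘ g₀ = B₆`, `B₃ ∘ g₀ = B₇`,
  `B₄ ∘ g₀ = B₈`) — the eight cubics are `{B₁, B₅} ∪ ⟨g₀, g₄⟩·B₂` up to scalars.
* §3 **Inscribed and circumscribed** (`ω² + ω + 1 = 0`): `B₂_smooth` (`∇B₂(p) ≠ 0` for `p ≠ 0`
  when `3 ≠ 0`), `B₂_tangent_triangle_xyz`, `B₂_tangent_triangle_omega`, `B₂_tangent_triangle_omega_sq`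
  — `B₂` passes through the nine vertices of `XYZ`, `𝐇[ω]`, `𝐇[ω²]` and its tangent at each vertex
  is a side of that triangle through the vertex; `B₁_tangent_triangle_one`, `B₁_tangent_triangle_omega`,
  `B₁_tangent_triangle_omega_sq` — the same for `B₁` and the triangles `𝐇[1], 𝐇[ω], 𝐇[ω²]`.
  (For `B₃, …, B₈` apply `g₄`, `g₀` of §2, which permute the triangles.)

NOT here: the first assertion of Prop. 5.2 (the `Bᵢ` cut out the points of order `9` — the group
law), the surfaces `S(3)`, `S(3)/Γ`, `S(3)′`.

## References
* [ArtebaniDolgachev2009] M. Artebani, I. Dolgachev, *The Hesse pencil of plane cubic curves*,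
  Enseign. Math. (2) 55 (2009) 235–273, §5, Proposition 5.2.
-/

set_option autoImplicit false

open MvPolynomial Matrix
open Literature.AlgebraicGeometry.HodgeTheory (hessianMatrix hessianMatrix_apply)

namespace Literature.AlgebraicGeometry.PlaneCurves

universe u

/-- The Hesse cubic `H_μ = X³ + Y³ + Z³ − 3μXYZ` (local notation, no definition). -/
local notation3 "𝐇[" μ "]" =>
  (X 0 ^ 3 + X 1 ^ 3 + X 2 ^ 3 - C (3 * μ) * (X 0 * X 1 * X 2) : MvPolynomial (Fin 3) _)

/-- `B₁ = X³ + εY³ + ε²Z³` (local notation, no definition). -/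
local notation3 "𝐁₁[" ω "]" => (X 0 ^ 3 + C ω * X 1 ^ 3 + C (ω ^ 2) * X 2 ^ 3 : MvPolynomial (Fin 3) _)

/-- `B₂ = X²Y + Y²Z + Z²X` (local notation, no definition). -/
local notation3 "𝐁₂" => (X 0 ^ 2 * X 1 + X 1 ^ 2 * X 2 + X 2 ^ 2 * X 0 : MvPolynomial (Fin 3) _)

section EightCubics

variable {K : Type u} [Field K]

/-- Derivations kill numerals (`no_index` so that `simp` matches literals). [folklore] -/
private theorem pderiv_ofNat'' (i : Fin 3) (n : ℕ) [n.AtLeastTwo] :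
    pderiv i (no_index (OfNat.ofNat n : MvPolynomial (Fin 3) K)) = 0 := by
  rw [← map_ofNat (C : K →+* MvPolynomial (Fin 3) K) n, pderiv_C]

/-- The linear forms of a `3 × 3` substitution, written out. [folklore] -/
private theorem toMvPolynomial_fin_three_e (M : Matrix (Fin 3) (Fin 3) K) (i : Fin 3) :
    M.toMvPolynomial i = C (M i 0) * X 0 + C (M i 1) * X 1 + C (M i 2) * X 2 := by
  simp only [Matrix.toMvPolynomial, Fin.sum_univ_three, ← C_mul_X_eq_monomial]

/-- `ω² + ω + 1 = 0 ⇒ ω³ = 1` in `K` and for `C ω`. [folklore] -/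
private theorem omega_pow_three_e {ω : K} (hω : ω ^ 2 + ω + 1 = 0) :
    ω ^ 3 = 1 ∧ (C ω : MvPolynomial (Fin 3) K) ^ 3 = 1 := by
  have h : ω ^ 3 = 1 := by linear_combination (ω - 1) * hω
  exact ⟨h, by rw [← C_pow, h, C_1]⟩

omit [Field K] in
/-- `![a, b, c] = ![a′, b′, c′]` componentwise. [folklore] -/
private theorem vec3_eq_iff (a b c a' b' c' : K) :
    (![a, b, c] : Fin 3 → K) = ![a', b', c'] ↔ a = a' ∧ b = b' ∧ c = c' := by
  constructor
  · intro h
    exact ⟨by simpa using congr_fun h 0, by simpa using congr_fun h 1, by simpa using congr_fun h 2⟩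
  · rintro ⟨rfl, rfl, rfl⟩
    rfl

/-- `![a, b, c] = 0` componentwise. [folklore] -/
private theorem vec3_eq_zero_iff (a b c : K) :
    (![a, b, c] : Fin 3 → K) = 0 ↔ a = 0 ∧ b = 0 ∧ c = 0 := by
  rw [show (0 : Fin 3 → K) = ![0, 0, 0] by ext i; fin_cases i <;> simp, vec3_eq_iff]

/-! ## §1 The inflection triangles: the Hessians of the eight cubics -/

/-- **`He(X²Y + aY²Z + bZ²X) = 8(3abXYZ − bX³ − a²Y³ − ab²Z³)`** (any field; the Hessian matrix
is `[[2Y, 2X, 2bZ], [2X, 2aZ, 2aY], [2bZ, 2aY, 2bX]]`). [cite: ArtebaniDolgachev2009, §5,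
Prop. 5.2 ("has one of the triangles of the Hesse pencil as inflection triangle")] -/
theorem det_hessianMatrix_cubic_xxy (a b : K) :
    (hessianMatrix (X 0 ^ 2 * X 1 + C a * (X 1 ^ 2 * X 2) + C b * (X 2 ^ 2 * X 0) :
        MvPolynomial (Fin 3) K)).det =
      C (24 * a * b) * (X 0 * X 1 * X 2) - C (8 * b) * X 0 ^ 3 - C (8 * a ^ 2) * X 1 ^ 3 -
        C (8 * a * b ^ 2) * X 2 ^ 3 := by
  have hH : hessianMatrix (X 0 ^ 2 * X 1 + C a * (X 1 ^ 2 * X 2) + C b * (X 2 ^ 2 * X 0) :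
      MvPolynomial (Fin 3) K) =
      Matrix.of ![![C 2 * X 1, C 2 * X 0, C (2 * b) * X 2],
        ![C 2 * X 0, C (2 * a) * X 2, C (2 * a) * X 1],
        ![C (2 * b) * X 2, C (2 * a) * X 1, C (2 * b) * X 0]] := by
    ext i j : 1
    rw [hessianMatrix_apply]
    fin_cases i <;> fin_cases j <;> simp [pderiv_X, pderiv_ofNat'', map_ofNat] <;> ring
  rw [hH, Matrix.det_fin_three]
  simp [map_mul, map_pow, map_ofNat]
  ring

/-- **`He(X²Z + aZ²Y + bY²X) = 8(3abXYZ − bX³ − ab²Y³ − a²Z³)`** (the `g₀ = (y ↔ z)`-image of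
the previous formula). [cite: ArtebaniDolgachev2009, §5, Prop. 5.2] -/
theorem det_hessianMatrix_cubic_xxz (a b : K) :
    (hessianMatrix (X 0 ^ 2 * X 2 + C a * (X 2 ^ 2 * X 1) + C b * (X 1 ^ 2 * X 0) :
        MvPolynomial (Fin 3) K)).det =
      C (24 * a * b) * (X 0 * X 1 * X 2) - C (8 * b) * X 0 ^ 3 - C (8 * a * b ^ 2) * X 1 ^ 3 -
        C (8 * a ^ 2) * X 2 ^ 3 := by
  have hH : hessianMatrix (X 0 ^ 2 * X 2 + C a * (X 2 ^ 2 * X 1) + C b * (X 1 ^ 2 * X 0) :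
      MvPolynomial (Fin 3) K) =
      Matrix.of ![![C 2 * X 2, C (2 * b) * X 1, C 2 * X 0],
        ![C (2 * b) * X 1, C (2 * b) * X 0, C (2 * a) * X 2],
        ![C 2 * X 0, C (2 * a) * X 2, C (2 * a) * X 1]] := by
    ext i j : 1
    rw [hessianMatrix_apply]
    fin_cases i <;> fin_cases j <;> simp [pderiv_X, pderiv_ofNat'', map_ofNat] <;> ring
  rw [hH, Matrix.det_fin_three]
  simp [map_mul, map_pow, map_ofNat]
  ring

/-- **`He(X³ + aY³ + bZ³) = 216ab·XYZ`** (any field): the Fermat-type cubics `B₁, B₅` have the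
triangle `E_∞ = XYZ` as inflection triangle. [cite: ArtebaniDolgachev2009, §5, Prop. 5.2] -/
theorem det_hessianMatrix_cubic_fermat (a b : K) :
    (hessianMatrix (X 0 ^ 3 + C a * X 1 ^ 3 + C b * X 2 ^ 3 : MvPolynomial (Fin 3) K)).det =
      C (216 * a * b) * (X 0 * X 1 * X 2) := by
  have hH : hessianMatrix (X 0 ^ 3 + C a * X 1 ^ 3 + C b * X 2 ^ 3 : MvPolynomial (Fin 3) K) =
      Matrix.of ![![C 6 * X 0, 0, 0], ![0, C (6 * a) * X 1, 0], ![0, 0, C (6 * b) * X 2]] := by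
    ext i j : 1
    rw [hessianMatrix_apply]
    fin_cases i <;> fin_cases j <;> simp [pderiv_X, pderiv_ofNat'', map_ofNat] <;> ring
  rw [hH, Matrix.det_fin_three]
  simp [map_mul, map_ofNat]
  ring

/-- **`B₂ : x²y + y²z + z²x` has `E_{−3} = H_1` as inflection triangle: `He(B₂) = −8·H_1`**
(any field); likewise `He(B₆) = −8·H_1` for `B₆ = x²z + y²x + z²y`.
[cite: ArtebaniDolgachev2009, §5, Prop. 5.2] -/
theorem det_hessianMatrix_B₂ :
    (hessianMatrix (𝐁₂ : MvPolynomial (Fin 3) K)).det = (-8 : K) • 𝐇[(1 : K)] ∧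
      (hessianMatrix (X 0 ^ 2 * X 2 + X 2 ^ 2 * X 1 + X 1 ^ 2 * X 0 : MvPolynomial (Fin 3) K)).det =
        (-8 : K) • 𝐇[(1 : K)] := by
  have h₂ := det_hessianMatrix_cubic_xxy (1 : K) 1
  have h₆ := det_hessianMatrix_cubic_xxz (1 : K) 1
  simp only [map_one, one_mul] at h₂ h₆
  refine ⟨?_, ?_⟩
  · rw [h₂, smul_eq_C_mul]
    simp only [map_mul, map_pow, map_neg, map_one, map_ofNat]
    ring
  · rw [h₆, smul_eq_C_mul]
    simp only [map_mul, map_pow, map_neg, map_one, map_ofNat]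
    ring

/-- **`B₃ : x²y + ε²y²z + εz²x` and `B₇ : x²z + εy²x + ε²z²y` have `E_{−3ε²} = H_{ε²}` as
inflection triangle: `He = −8ε·H_{ε²}`** (`ω² + ω + 1 = 0`).
[cite: ArtebaniDolgachev2009, §5, Prop. 5.2] -/
theorem det_hessianMatrix_B₃ {ω : K} (hω : ω ^ 2 + ω + 1 = 0) :
    (hessianMatrix (X 0 ^ 2 * X 1 + C (ω ^ 2) * (X 1 ^ 2 * X 2) + C ω * (X 2 ^ 2 * X 0) :
        MvPolynomial (Fin 3) K)).det = (-8 * ω) • 𝐇[ω ^ 2] ∧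
      (hessianMatrix (X 0 ^ 2 * X 2 + C (ω ^ 2) * (X 2 ^ 2 * X 1) + C ω * (X 1 ^ 2 * X 0) :
        MvPolynomial (Fin 3) K)).det = (-8 * ω) • 𝐇[ω ^ 2] := by
  obtain ⟨-, hC3⟩ := omega_pow_three_e hω
  refine ⟨?_, ?_⟩
  · rw [det_hessianMatrix_cubic_xxy, smul_eq_C_mul]
    simp only [map_mul, map_pow, map_neg, map_ofNat]
    linear_combination (-8 * X 1 ^ 3 * C ω - 8 * X 2 ^ 3 * C ω : MvPolynomial (Fin 3) K) * hC3
  · rw [det_hessianMatrix_cubic_xxz, smul_eq_C_mul]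
    simp only [map_mul, map_pow, map_neg, map_ofNat]
    linear_combination (-8 * X 1 ^ 3 * C ω - 8 * X 2 ^ 3 * C ω : MvPolynomial (Fin 3) K) * hC3

/-- **`B₄ : x²y + εy²z + ε²z²x` and `B₈ : x²z + ε²y²x + εz²y` have `E_{−3ε} = H_ε` as inflection
triangle: `He = −8ε²·H_ε`** (`ω² + ω + 1 = 0`). [cite: ArtebaniDolgachev2009, §5, Prop. 5.2] -/
theorem det_hessianMatrix_B₄ {ω : K} (hω : ω ^ 2 + ω + 1 = 0) :
    (hessianMatrix (X 0 ^ 2 * X 1 + C ω * (X 1 ^ 2 * X 2) + C (ω ^ 2) * (X 2 ^ 2 * X 0) :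
        MvPolynomial (Fin 3) K)).det = (-8 * ω ^ 2) • 𝐇[ω] ∧
      (hessianMatrix (X 0 ^ 2 * X 2 + C ω * (X 2 ^ 2 * X 1) + C (ω ^ 2) * (X 1 ^ 2 * X 0) :
        MvPolynomial (Fin 3) K)).det = (-8 * ω ^ 2) • 𝐇[ω] := by
  obtain ⟨-, hC3⟩ := omega_pow_three_e hω
  refine ⟨?_, ?_⟩
  · rw [det_hessianMatrix_cubic_xxy, smul_eq_C_mul]
    simp only [map_mul, map_pow, map_neg, map_ofNat]
    linear_combination (-8 * X 2 ^ 3 * C ω ^ 2 : MvPolynomial (Fin 3) K) * hC3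
  · rw [det_hessianMatrix_cubic_xxz, smul_eq_C_mul]
    simp only [map_mul, map_pow, map_neg, map_ofNat]
    linear_combination (-8 * X 1 ^ 3 * C ω ^ 2 : MvPolynomial (Fin 3) K) * hC3

/-- **`B₁ : x³ + εy³ + ε²z³` and `B₅ : x³ + ε²y³ + εz³` have `E_∞ = XYZ` as inflection
triangle: `He = 216·XYZ`** (`ω² + ω + 1 = 0`). [cite: ArtebaniDolgachev2009, §5, Prop. 5.2] -/
theorem det_hessianMatrix_B₁ {ω : K} (hω : ω ^ 2 + ω + 1 = 0) :
    (hessianMatrix (𝐁₁[ω] : MvPolynomial (Fin 3) K)).det = C 216 * (X 0 * X 1 * X 2) ∧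
      (hessianMatrix (X 0 ^ 3 + C (ω ^ 2) * X 1 ^ 3 + C ω * X 2 ^ 3 : MvPolynomial (Fin 3) K)).det =
        C 216 * (X 0 * X 1 * X 2) := by
  have hω3 := (omega_pow_three_e hω).1
  have e : ω * ω ^ 2 = 1 := by rw [← pow_succ', hω3]
  have e' : ω ^ 2 * ω = 1 := by rw [← pow_succ, hω3]
  refine ⟨?_, ?_⟩
  · rw [det_hessianMatrix_cubic_fermat, mul_assoc, e, mul_one]
  · rw [det_hessianMatrix_cubic_fermat, mul_assoc, e', mul_one]

/-! ## §2 `Γ`-invariance; the eight cubics under the Hessian group -/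

/-- **`Γ = ⟨g₁, g₂⟩` preserves `B₁` and `B₂`**: `B₁ ∘ g₁ = ω²·B₁`, `B₁ ∘ g₂ = B₁`, `B₂ ∘ g₁ = B₂`,
`B₂ ∘ g₂ = ω·B₂` (`g₁(x, y, z) = (y, z, x)`, `g₂ = diag(1, ω, ω²)`, `ω² + ω + 1 = 0`) — each
`Bᵢ = p⁻¹(…)` is invariant under the group `Γ` by which `p` is the quotient.
[cite: ArtebaniDolgachev2009, §5 (Prop. 5.1–5.2: `p : ℙ² → ℙ²/Γ`, `Bᵢ = p⁻¹(β(α(Eᵢ)))`)] -/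
theorem B_bind₁_Gamma {ω : K} (hω : ω ^ 2 + ω + 1 = 0) :
    bind₁ (Matrix.of ![![(0 : K), 1, 0], ![0, 0, 1], ![1, 0, 0]] :
        Matrix (Fin 3) (Fin 3) K).toMvPolynomial 𝐁₁[ω] = (ω ^ 2) • 𝐁₁[ω] ∧
      bind₁ (Matrix.of ![![(1 : K), 0, 0], ![0, ω, 0], ![0, 0, ω ^ 2]] :
        Matrix (Fin 3) (Fin 3) K).toMvPolynomial 𝐁₁[ω] = 𝐁₁[ω] ∧
      bind₁ (Matrix.of ![![(0 : K), 1, 0], ![0, 0, 1], ![1, 0, 0]] :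
        Matrix (Fin 3) (Fin 3) K).toMvPolynomial (𝐁₂ : MvPolynomial (Fin 3) K) = 𝐁₂ ∧
      bind₁ (Matrix.of ![![(1 : K), 0, 0], ![0, ω, 0], ![0, 0, ω ^ 2]] :
        Matrix (Fin 3) (Fin 3) K).toMvPolynomial (𝐁₂ : MvPolynomial (Fin 3) K) = ω • 𝐁₂ := by
  obtain ⟨-, hC3⟩ := omega_pow_three_e hω
  refine ⟨?_, ?_, ?_, ?_⟩
  · simp only [map_add, map_mul, map_pow, bind₁_X_right, bind₁_C_right, toMvPolynomial_fin_three_e,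
      Matrix.of_apply, Matrix.cons_val_zero, Matrix.cons_val_one, Matrix.cons_val_two,
      Matrix.head_cons, Matrix.tail_cons, map_one, map_zero, smul_eq_C_mul]
    linear_combination (-(X 1 ^ 3) - (X 2 ^ 3 * C ω) : MvPolynomial (Fin 3) K) * hC3
  · simp only [map_add, map_mul, map_pow, bind₁_X_right, bind₁_C_right, toMvPolynomial_fin_three_e,
      Matrix.of_apply, Matrix.cons_val_zero, Matrix.cons_val_one, Matrix.cons_val_two,
      Matrix.head_cons, Matrix.tail_cons, map_one, map_zero]
    linear_combination (X 1 ^ 3 * C ω + X 2 ^ 3 * C ω ^ 5 + X 2 ^ 3 * C ω ^ 2 : MvPolynomial (Fin 3) K) * hC3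
  · simp only [map_add, map_mul, map_pow, bind₁_X_right, toMvPolynomial_fin_three_e,
      Matrix.of_apply, Matrix.cons_val_zero, Matrix.cons_val_one, Matrix.cons_val_two,
      Matrix.head_cons, Matrix.tail_cons, map_one, map_zero]
    ring
  · simp only [map_add, map_mul, map_pow, bind₁_X_right, toMvPolynomial_fin_three_e,
      Matrix.of_apply, Matrix.cons_val_zero, Matrix.cons_val_one, Matrix.cons_val_two,
      Matrix.head_cons, Matrix.tail_cons, map_one, map_zero, smul_eq_C_mul]
    linear_combination (X 0 * X 2 ^ 2 * C ω + X 1 ^ 2 * X 2 * C ω : MvPolynomial (Fin 3) K) * hC3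

/-- **The stabilizer `⟨g₃, g₄⟩` and `g₀` permute the eight cubics**: `B₂ ∘ g₄ = ω·B₃`,
`B₂ ∘ g₄² = ω²·B₄` (`g₄ = diag(1, ω, ω)`, `g₄² = diag(1, ω², ω²)`), and `g₀ = (y ↔ z)` carries
`B₁, B₂, B₃, B₄` to `B₅, B₆, B₇, B₈` (`ω² + ω + 1 = 0`) — so the eight cubics are `B₁, B₅` and the
`⟨g₀, g₄⟩`-images of `B₂`, and §3 for `B₃, …, B₈` follows by applying these projectivities, which
permute the four triangles (`HessePencilHessianGroup`).
[cite: ArtebaniDolgachev2009, §5, Prop. 5.2 (the eight equations); §4 (`g₀, g₃, g₄`)] -/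
theorem B_bind₁_g₄_g₀ {ω : K} (hω : ω ^ 2 + ω + 1 = 0) :
    bind₁ (Matrix.of ![![(1 : K), 0, 0], ![0, ω, 0], ![0, 0, ω]] :
        Matrix (Fin 3) (Fin 3) K).toMvPolynomial (𝐁₂ : MvPolynomial (Fin 3) K) =
      ω • (X 0 ^ 2 * X 1 + C (ω ^ 2) * (X 1 ^ 2 * X 2) + C ω * (X 2 ^ 2 * X 0)) ∧
    bind₁ (Matrix.of ![![(1 : K), 0, 0], ![0, ω ^ 2, 0], ![0, 0, ω ^ 2]] :
        Matrix (Fin 3) (Fin 3) K).toMvPolynomial (𝐁₂ : MvPolynomial (Fin 3) K) =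
      (ω ^ 2) • (X 0 ^ 2 * X 1 + C ω * (X 1 ^ 2 * X 2) + C (ω ^ 2) * (X 2 ^ 2 * X 0)) ∧
    bind₁ (Matrix.of ![![(1 : K), 0, 0], ![0, 0, 1], ![0, 1, 0]] :
        Matrix (Fin 3) (Fin 3) K).toMvPolynomial 𝐁₁[ω] =
      (X 0 ^ 3 + C (ω ^ 2) * X 1 ^ 3 + C ω * X 2 ^ 3 : MvPolynomial (Fin 3) K) ∧
    bind₁ (Matrix.of ![![(1 : K), 0, 0], ![0, 0, 1], ![0, 1, 0]] :
        Matrix (Fin 3) (Fin 3) K).toMvPolynomial (𝐁₂ : MvPolynomial (Fin 3) K) =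
      (X 0 ^ 2 * X 2 + X 2 ^ 2 * X 1 + X 1 ^ 2 * X 0 : MvPolynomial (Fin 3) K) ∧
    bind₁ (Matrix.of ![![(1 : K), 0, 0], ![0, 0, 1], ![0, 1, 0]] :
        Matrix (Fin 3) (Fin 3) K).toMvPolynomial
        (X 0 ^ 2 * X 1 + C (ω ^ 2) * (X 1 ^ 2 * X 2) + C ω * (X 2 ^ 2 * X 0) :
          MvPolynomial (Fin 3) K) =
      (X 0 ^ 2 * X 2 + C (ω ^ 2) * (X 2 ^ 2 * X 1) + C ω * (X 1 ^ 2 * X 0) : MvPolynomial (Fin 3) K) ∧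
    bind₁ (Matrix.of ![![(1 : K), 0, 0], ![0, 0, 1], ![0, 1, 0]] :
        Matrix (Fin 3) (Fin 3) K).toMvPolynomial
        (X 0 ^ 2 * X 1 + C ω * (X 1 ^ 2 * X 2) + C (ω ^ 2) * (X 2 ^ 2 * X 0) :
          MvPolynomial (Fin 3) K) =
      (X 0 ^ 2 * X 2 + C ω * (X 2 ^ 2 * X 1) + C (ω ^ 2) * (X 1 ^ 2 * X 0) : MvPolynomial (Fin 3) K) := by
  obtain ⟨-, hC3⟩ := omega_pow_three_e hω
  refine ⟨?_, ?_, ?_, ?_, ?_, ?_⟩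
  · simp only [map_add, map_mul, map_pow, bind₁_X_right, toMvPolynomial_fin_three_e,
      Matrix.of_apply, Matrix.cons_val_zero, Matrix.cons_val_one, Matrix.cons_val_two,
      Matrix.head_cons, Matrix.tail_cons, map_one, map_zero, smul_eq_C_mul]
    ring
  · simp only [map_add, map_mul, map_pow, bind₁_X_right, toMvPolynomial_fin_three_e,
      Matrix.of_apply, Matrix.cons_val_zero, Matrix.cons_val_one, Matrix.cons_val_two,
      Matrix.head_cons, Matrix.tail_cons, map_one, map_zero, smul_eq_C_mul]
    linear_combination (X 1 ^ 2 * X 2 * C ω ^ 3 : MvPolynomial (Fin 3) K) * hC3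
  · simp only [map_add, map_mul, map_pow, bind₁_X_right, bind₁_C_right, toMvPolynomial_fin_three_e,
      Matrix.of_apply, Matrix.cons_val_zero, Matrix.cons_val_one, Matrix.cons_val_two,
      Matrix.head_cons, Matrix.tail_cons, map_one, map_zero]
    ring
  · simp only [map_add, map_mul, map_pow, bind₁_X_right, toMvPolynomial_fin_three_e,
      Matrix.of_apply, Matrix.cons_val_zero, Matrix.cons_val_one, Matrix.cons_val_two,
      Matrix.head_cons, Matrix.tail_cons, map_one, map_zero]
    ring
  · simp only [map_add, map_mul, map_pow, bind₁_X_right, bind₁_C_right, toMvPolynomial_fin_three_e,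
      Matrix.of_apply, Matrix.cons_val_zero, Matrix.cons_val_one, Matrix.cons_val_two,
      Matrix.head_cons, Matrix.tail_cons, map_one, map_zero]
    ring
  · simp only [map_add, map_mul, map_pow, bind₁_X_right, bind₁_C_right, toMvPolynomial_fin_three_e,
      Matrix.of_apply, Matrix.cons_val_zero, Matrix.cons_val_one, Matrix.cons_val_two,
      Matrix.head_cons, Matrix.tail_cons, map_one, map_zero]
    ring

/-! ## §3 Inscribed and circumscribed triangles -/

/-- `B₂(p) = p₀²p₁ + p₁²p₂ + p₂²p₀` and `∇B₂(p) = (2p₀p₁ + p₂², p₀² + 2p₁p₂, p₁² + 2p₂p₀)`.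
[folklore] -/
private theorem B₂_eval (p : Fin 3 → K) :
    eval p (𝐁₂ : MvPolynomial (Fin 3) K) = p 0 ^ 2 * p 1 + p 1 ^ 2 * p 2 + p 2 ^ 2 * p 0 ∧
      (fun i => eval p (pderiv i (𝐁₂ : MvPolynomial (Fin 3) K))) =
        ![2 * p 0 * p 1 + p 2 ^ 2, p 0 ^ 2 + 2 * p 1 * p 2, p 1 ^ 2 + 2 * p 2 * p 0] := by
  refine ⟨by simp, ?_⟩
  funext i
  fin_cases i <;> simp [pderiv_X, map_ofNat] <;> ring

/-- `B₁(p) = p₀³ + ωp₁³ + ω²p₂³` and `∇B₁(p) = (3p₀², 3ωp₁², 3ω²p₂²)`. [folklore] -/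
private theorem B₁_eval (ω : K) (p : Fin 3 → K) :
    eval p (𝐁₁[ω] : MvPolynomial (Fin 3) K) = p 0 ^ 3 + ω * p 1 ^ 3 + ω ^ 2 * p 2 ^ 3 ∧
      (fun i => eval p (pderiv i (𝐁₁[ω] : MvPolynomial (Fin 3) K))) =
        ![3 * p 0 ^ 2, 3 * ω * p 1 ^ 2, 3 * ω ^ 2 * p 2 ^ 2] := by
  refine ⟨by simp, ?_⟩
  funext i
  fin_cases i <;> simp [pderiv_X, map_ofNat] <;> ring

/-- **`B₂` is a smooth cubic when `3 ≠ 0`**: `∇B₂(p) = 0` forces `p = 0` (from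
`z² = −2xy`, `x² = −2yz`, `y² = −2zx`: `9(xyz)² = 0`, then `x³ = y³ = z³ = 0`); so the nine points
`B₂ ∩ He(B₂) = B₂ ∩ H_1` are its nine flexes (`PlaneCubicNineFlexes`).
[cite: ArtebaniDolgachev2009, §5, Prop. 5.2 ("plane cubic curves … inflection triangle")] -/
theorem B₂_smooth (h3 : (3 : K) ≠ 0) {p : Fin 3 → K}
    (hp : (fun i => eval p (pderiv i (𝐁₂ : MvPolynomial (Fin 3) K))) = 0) : p = 0 := by
  rw [(B₂_eval p).2] at hp
  have h0 := congr_fun hp 0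
  have h1 := congr_fun hp 1
  have h2 := congr_fun hp 2
  simp only [Matrix.cons_val_zero, Matrix.cons_val_one, Matrix.cons_val_two, Matrix.head_cons,
    Matrix.tail_cons, Pi.zero_apply] at h0 h1 h2
  have h9 : (9 : K) ≠ 0 := by
    rw [show (9 : K) = 3 * 3 by norm_num]
    exact mul_ne_zero h3 h3
  -- `9(p₀p₁p₂)² = 0`
  have hprod : p 0 * p 1 * p 2 = 0 := by
    have h : 9 * (p 0 * p 1 * p 2) ^ 2 = 0 := by
      linear_combination ((p 1 ^ 2 + 2 * p 2 * p 0) * (2 * p 0 * p 1 + p 2 ^ 2) -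
          (p 1 ^ 2 + 2 * p 2 * p 0) * (2 * p 0 * p 1) - (2 * p 2 * p 0) * (2 * p 0 * p 1 + p 2 ^ 2) +
          (2 * p 2 * p 0) * (2 * p 0 * p 1)) * h1 +
        (-(2 * p 1 * p 2) * (2 * p 0 * p 1 + p 2 ^ 2) + (2 * p 1 * p 2) * (2 * p 0 * p 1)) * h2 +
        ((2 * p 1 * p 2) * (2 * p 2 * p 0)) * h0
    exact (pow_eq_zero_iff two_ne_zero).1 ((mul_eq_zero.1 h).resolve_left h9)
  have hx : p 0 ^ 3 = 0 := by linear_combination p 0 * h1 - 2 * hprod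
  have hy : p 1 ^ 3 = 0 := by linear_combination p 1 * h2 - 2 * hprod
  have hz : p 2 ^ 3 = 0 := by linear_combination p 2 * h0 - 2 * hprod
  funext i
  fin_cases i
  · exact (pow_eq_zero_iff three_ne_zero).1 hx
  · exact (pow_eq_zero_iff three_ne_zero).1 hy
  · exact (pow_eq_zero_iff three_ne_zero).1 hz

/-- **The tangency scalars of §3 are units when `3 ≠ 0`** (so "`∇B(v) = c·∇L`" there really says
that the tangent line of `B` at the vertex `v` IS the side `L`): `(2ω² + 1)(2ω + 1) = 3` and
`(ω + 2)(ω² + 2) = 3` for `ω² + ω + 1 = 0`. [cite: ArtebaniDolgachev2009, §5, Prop. 5.2 ("is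
tangent to one side of the triangle at each vertex")] -/
theorem omega_scalars_ne_zero (h3 : (3 : K) ≠ 0) {ω : K} (hω : ω ^ 2 + ω + 1 = 0) :
    2 * ω ^ 2 + 1 ≠ 0 ∧ 2 * ω + 1 ≠ 0 ∧ ω + 2 ≠ 0 ∧ ω ^ 2 + 2 ≠ 0 := by
  have e1 : (2 * ω ^ 2 + 1) * (2 * ω + 1) = 3 := by linear_combination (4 * ω - 2) * hω
  have e2 : (ω + 2) * (ω ^ 2 + 2) = 3 := by linear_combination (ω + 1) * hω
  rw [← e1] at h3
  have h3' : (ω + 2) * (ω ^ 2 + 2) ≠ 0 := by rw [e2, ← e1]; exact h3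
  exact ⟨(mul_ne_zero_iff.1 h3).1, (mul_ne_zero_iff.1 h3).2, (mul_ne_zero_iff.1 h3').1,
    (mul_ne_zero_iff.1 h3').2⟩

/-- **The vertices of the triangles `E_{−3ε} = H_ε` and `E_{−3ε²} = H_{ε²}`**: the points
`(ε², 1, 1), (1, ε², 1), (1, 1, ε²)` are singular points of `H_ε`, and `(ε, 1, 1), (1, ε, 1), (1, 1, ε)`
of `H_{ε²}` (`ω² + ω + 1 = 0`; companion of Q2242 `hesse_one_vertices`; in Artebani–Dolgachev's list
these are `v₉, v₁₀, v₁₁` and `v₆, v₇, v₈`). [cite: ArtebaniDolgachev2009, §2 (the vertices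
`v₀, …, v₁₁` of the triangles)] -/
theorem hesse_omega_vertices {ω : K} (hω : ω ^ 2 + ω + 1 = 0) :
    (∀ v ∈ [![ω ^ 2, (1 : K), 1], ![(1 : K), ω ^ 2, 1], ![(1 : K), 1, ω ^ 2]],
      eval v 𝐇[ω] = 0 ∧ (fun i => eval v (pderiv i 𝐇[ω])) = 0) ∧
    (∀ v ∈ [![ω, (1 : K), 1], ![(1 : K), ω, 1], ![(1 : K), 1, ω]],
      eval v 𝐇[ω ^ 2] = 0 ∧ (fun i => eval v (pderiv i 𝐇[ω ^ 2])) = 0) := by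
  constructor
  · intro v hv
    simp only [List.mem_cons, List.not_mem_nil, or_false] at hv
    rcases hv with rfl | rfl | rfl
    · rw [hesse_eval, hesse_eval_pderiv]
      refine ⟨?_, ?_⟩
      · simp only [Matrix.cons_val_zero, Matrix.cons_val_one, Matrix.cons_val_two, Matrix.head_cons,
      Matrix.tail_cons]
        linear_combination (ω ^ 4 - (ω ^ 3) - 2 * ω + 2) * hω
      · simp only [Matrix.cons_val_zero, Matrix.cons_val_one, Matrix.cons_val_two, Matrix.head_cons,
          Matrix.tail_cons, vec3_eq_zero_iff]
        exact ⟨by linear_combination (3 * ω ^ 2 - 3 * ω) * hω, by linear_combination (-3 * ω + 3) * hω, by linear_combination (-3 * ω + 3) * hω⟩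
    · rw [hesse_eval, hesse_eval_pderiv]
      refine ⟨?_, ?_⟩
      · simp only [Matrix.cons_val_zero, Matrix.cons_val_one, Matrix.cons_val_two, Matrix.head_cons,
      Matrix.tail_cons]
        linear_combination (ω ^ 4 - (ω ^ 3) - 2 * ω + 2) * hω
      · simp only [Matrix.cons_val_zero, Matrix.cons_val_one, Matrix.cons_val_two, Matrix.head_cons,
          Matrix.tail_cons, vec3_eq_zero_iff]
        exact ⟨by linear_combination (-3 * ω + 3) * hω, by linear_combination (3 * ω ^ 2 - 3 * ω) * hω, by linear_combination (-3 * ω + 3) * hω⟩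
    · rw [hesse_eval, hesse_eval_pderiv]
      refine ⟨?_, ?_⟩
      · simp only [Matrix.cons_val_zero, Matrix.cons_val_one, Matrix.cons_val_two, Matrix.head_cons,
      Matrix.tail_cons]
        linear_combination (ω ^ 4 - (ω ^ 3) - 2 * ω + 2) * hω
      · simp only [Matrix.cons_val_zero, Matrix.cons_val_one, Matrix.cons_val_two, Matrix.head_cons,
          Matrix.tail_cons, vec3_eq_zero_iff]
        exact ⟨by linear_combination (-3 * ω + 3) * hω, by linear_combination (-3 * ω + 3) * hω, by linear_combination (3 * ω ^ 2 - 3 * ω) * hω⟩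
  · intro v hv
    simp only [List.mem_cons, List.not_mem_nil, or_false] at hv
    rcases hv with rfl | rfl | rfl
    · rw [hesse_eval, hesse_eval_pderiv]
      refine ⟨?_, ?_⟩
      · simp only [Matrix.cons_val_zero, Matrix.cons_val_one, Matrix.cons_val_two, Matrix.head_cons,
      Matrix.tail_cons]
        linear_combination (-2 * ω + 2) * hω
      · simp only [Matrix.cons_val_zero, Matrix.cons_val_one, Matrix.cons_val_two, Matrix.head_cons,
          Matrix.tail_cons, vec3_eq_zero_iff]
        exact ⟨by ring, by linear_combination (-3 * ω + 3) * hω, by linear_combination (-3 * ω + 3) * hω⟩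
    · rw [hesse_eval, hesse_eval_pderiv]
      refine ⟨?_, ?_⟩
      · simp only [Matrix.cons_val_zero, Matrix.cons_val_one, Matrix.cons_val_two, Matrix.head_cons,
      Matrix.tail_cons]
        linear_combination (-2 * ω + 2) * hω
      · simp only [Matrix.cons_val_zero, Matrix.cons_val_one, Matrix.cons_val_two, Matrix.head_cons,
          Matrix.tail_cons, vec3_eq_zero_iff]
        exact ⟨by linear_combination (-3 * ω + 3) * hω, by ring, by linear_combination (-3 * ω + 3) * hω⟩
    · rw [hesse_eval, hesse_eval_pderiv]
      refine ⟨?_, ?_⟩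
      · simp only [Matrix.cons_val_zero, Matrix.cons_val_one, Matrix.cons_val_two, Matrix.head_cons,
      Matrix.tail_cons]
        linear_combination (-2 * ω + 2) * hω
      · simp only [Matrix.cons_val_zero, Matrix.cons_val_one, Matrix.cons_val_two, Matrix.head_cons,
          Matrix.tail_cons, vec3_eq_zero_iff]
        exact ⟨by linear_combination (-3 * ω + 3) * hω, by linear_combination (-3 * ω + 3) * hω, by ring⟩

/-- **`B₂` is inscribed and circumscribed to the triangle `E_∞ = XYZ`**: it passes through the
vertices `(1,0,0), (0,1,0), (0,0,1)` with tangent lines `Y = 0`, `Z = 0`, `X = 0` — a side through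
the vertex each time (`∇B₂ = (0,1,0), (0,0,1), (1,0,0)` there; any field).
[cite: ArtebaniDolgachev2009, §5, Prop. 5.2 ("inscribed and circumscribed to the other three
triangles (i.e. is tangent to one side of the triangle at each vertex)")] -/
theorem B₂_tangent_triangle_xyz :
    (eval ![(1 : K), 0, 0] (𝐁₂ : MvPolynomial (Fin 3) K) = 0 ∧
        (fun i => eval ![(1 : K), 0, 0] (pderiv i (𝐁₂ : MvPolynomial (Fin 3) K))) = (1 : K) • ![(0 : K), 1, 0] ∧
        ![(0 : K), 1, 0] ⬝ᵥ ![(1 : K), 0, 0] = (0 : K)) ∧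
      (eval ![(0 : K), 1, 0] (𝐁₂ : MvPolynomial (Fin 3) K) = 0 ∧
        (fun i => eval ![(0 : K), 1, 0] (pderiv i (𝐁₂ : MvPolynomial (Fin 3) K))) = (1 : K) • ![(0 : K), 0, 1] ∧
        ![(0 : K), 0, 1] ⬝ᵥ ![(0 : K), 1, 0] = (0 : K)) ∧
      (eval ![(0 : K), 0, 1] (𝐁₂ : MvPolynomial (Fin 3) K) = 0 ∧
        (fun i => eval ![(0 : K), 0, 1] (pderiv i (𝐁₂ : MvPolynomial (Fin 3) K))) = (1 : K) • ![(1 : K), 0, 0] ∧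
        ![(1 : K), 0, 0] ⬝ᵥ ![(0 : K), 0, 1] = (0 : K)) := by
  refine ⟨⟨?_, ?_, ?_⟩, ⟨?_, ?_, ?_⟩, ⟨?_, ?_, ?_⟩⟩
  · rw [(B₂_eval _).1]
    simp only [Matrix.cons_val_zero, Matrix.cons_val_one, Matrix.cons_val_two, Matrix.head_cons,
      Matrix.tail_cons]
    ring
  · rw [(B₂_eval _).2]
    simp only [Matrix.smul_cons, Matrix.smul_empty, smul_eq_mul, Matrix.cons_val_zero, Matrix.cons_val_one,
      Matrix.cons_val_two, Matrix.head_cons, Matrix.tail_cons, vec3_eq_iff]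
    exact ⟨by ring, by ring, by ring⟩
  · simp only [dotProduct, Fin.sum_univ_three, Matrix.cons_val_zero, Matrix.cons_val_one,
      Matrix.cons_val_two, Matrix.head_cons, Matrix.tail_cons]
    ring
  · rw [(B₂_eval _).1]
    simp only [Matrix.cons_val_zero, Matrix.cons_val_one, Matrix.cons_val_two, Matrix.head_cons,
      Matrix.tail_cons]
    ring
  · rw [(B₂_eval _).2]
    simp only [Matrix.smul_cons, Matrix.smul_empty, smul_eq_mul, Matrix.cons_val_zero, Matrix.cons_val_one,
      Matrix.cons_val_two, Matrix.head_cons, Matrix.tail_cons, vec3_eq_iff]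
    exact ⟨by ring, by ring, by ring⟩
  · simp only [dotProduct, Fin.sum_univ_three, Matrix.cons_val_zero, Matrix.cons_val_one,
      Matrix.cons_val_two, Matrix.head_cons, Matrix.tail_cons]
    ring
  · rw [(B₂_eval _).1]
    simp only [Matrix.cons_val_zero, Matrix.cons_val_one, Matrix.cons_val_two, Matrix.head_cons,
      Matrix.tail_cons]
    ring
  · rw [(B₂_eval _).2]
    simp only [Matrix.smul_cons, Matrix.smul_empty, smul_eq_mul, Matrix.cons_val_zero, Matrix.cons_val_one,
      Matrix.cons_val_two, Matrix.head_cons, Matrix.tail_cons, vec3_eq_iff]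
    exact ⟨by ring, by ring, by ring⟩
  · simp only [dotProduct, Fin.sum_univ_three, Matrix.cons_val_zero, Matrix.cons_val_one,
      Matrix.cons_val_two, Matrix.head_cons, Matrix.tail_cons]
    ring

/-- **`B₂` is inscribed and circumscribed to the triangle
`E_{−3ε} = H_ε = (X+εY+Z)(X+ε²Y+ε²Z)(X+Y+εZ)`** (Q2242 `hesse_omega_eq_prod`): at its vertices
`(ε²,1,1), (1,ε²,1), (1,1,ε²)` (`hesse_omega_vertices`) `B₂` vanishes and `∇B₂` is `(2ε²+1)·(1,ε,1)`,
`(2ε²+1)·(1,1,ε)`, `(ε+2)·(1,ε²,ε²)` — the sides `X+εY+Z`, `X+Y+εZ`, `X+ε²Y+ε²Z` through those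
vertices (`ω² + ω + 1 = 0`; the scalars are non-zero when `3 ≠ 0`, `omega_scalars_ne_zero`).
[cite: ArtebaniDolgachev2009, §5, Prop. 5.2 ("inscribed and circumscribed to the other three
triangles (i.e. is tangent to one side of the triangle at each vertex)")] -/
theorem B₂_tangent_triangle_omega {ω : K} (hω : ω ^ 2 + ω + 1 = 0) :
    (eval ![ω ^ 2, (1 : K), 1] (𝐁₂ : MvPolynomial (Fin 3) K) = 0 ∧
        (fun i => eval ![ω ^ 2, (1 : K), 1] (pderiv i (𝐁₂ : MvPolynomial (Fin 3) K))) = (2 * ω ^ 2 + 1 : K) • ![(1 : K), ω, 1] ∧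
        ![(1 : K), ω, 1] ⬝ᵥ ![ω ^ 2, (1 : K), 1] = (0 : K)) ∧
      (eval ![(1 : K), ω ^ 2, 1] (𝐁₂ : MvPolynomial (Fin 3) K) = 0 ∧
        (fun i => eval ![(1 : K), ω ^ 2, 1] (pderiv i (𝐁₂ : MvPolynomial (Fin 3) K))) = (2 * ω ^ 2 + 1 : K) • ![(1 : K), 1, ω] ∧
        ![(1 : K), 1, ω] ⬝ᵥ ![(1 : K), ω ^ 2, 1] = (0 : K)) ∧
      (eval ![(1 : K), 1, ω ^ 2] (𝐁₂ : MvPolynomial (Fin 3) K) = 0 ∧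
        (fun i => eval ![(1 : K), 1, ω ^ 2] (pderiv i (𝐁₂ : MvPolynomial (Fin 3) K))) = (ω + 2 : K) • ![(1 : K), ω ^ 2, ω ^ 2] ∧
        ![(1 : K), ω ^ 2, ω ^ 2] ⬝ᵥ ![(1 : K), 1, ω ^ 2] = (0 : K)) := by
  refine ⟨⟨?_, ?_, ?_⟩, ⟨?_, ?_, ?_⟩, ⟨?_, ?_, ?_⟩⟩
  · rw [(B₂_eval _).1]
    simp only [Matrix.cons_val_zero, Matrix.cons_val_one, Matrix.cons_val_two, Matrix.head_cons,
      Matrix.tail_cons]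
    linear_combination (ω ^ 2 - (ω) + 1) * hω
  · rw [(B₂_eval _).2]
    simp only [Matrix.smul_cons, Matrix.smul_empty, smul_eq_mul, Matrix.cons_val_zero, Matrix.cons_val_one,
      Matrix.cons_val_two, Matrix.head_cons, Matrix.tail_cons, vec3_eq_iff]
    exact ⟨by ring, by linear_combination (ω ^ 2 - 3 * ω + 2) * hω, by ring⟩
  · simp only [dotProduct, Fin.sum_univ_three, Matrix.cons_val_zero, Matrix.cons_val_one,
      Matrix.cons_val_two, Matrix.head_cons, Matrix.tail_cons]
    linear_combination (1) * hω
  · rw [(B₂_eval _).1]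
    simp only [Matrix.cons_val_zero, Matrix.cons_val_one, Matrix.cons_val_two, Matrix.head_cons,
      Matrix.tail_cons]
    linear_combination (ω ^ 2 - (ω) + 1) * hω
  · rw [(B₂_eval _).2]
    simp only [Matrix.smul_cons, Matrix.smul_empty, smul_eq_mul, Matrix.cons_val_zero, Matrix.cons_val_one,
      Matrix.cons_val_two, Matrix.head_cons, Matrix.tail_cons, vec3_eq_iff]
    exact ⟨by ring, by ring, by linear_combination (ω ^ 2 - 3 * ω + 2) * hω⟩
  · simp only [dotProduct, Fin.sum_univ_three, Matrix.cons_val_zero, Matrix.cons_val_one,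
      Matrix.cons_val_two, Matrix.head_cons, Matrix.tail_cons]
    linear_combination (1) * hω
  · rw [(B₂_eval _).1]
    simp only [Matrix.cons_val_zero, Matrix.cons_val_one, Matrix.cons_val_two, Matrix.head_cons,
      Matrix.tail_cons]
    linear_combination (ω ^ 2 - (ω) + 1) * hω
  · rw [(B₂_eval _).2]
    simp only [Matrix.smul_cons, Matrix.smul_empty, smul_eq_mul, Matrix.cons_val_zero, Matrix.cons_val_one,
      Matrix.cons_val_two, Matrix.head_cons, Matrix.tail_cons, vec3_eq_iff]
    exact ⟨by linear_combination (ω ^ 2 - (ω)) * hω, by linear_combination (-(ω) + 1) * hω, by linear_combination (-(ω) + 1) * hω⟩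
  · simp only [dotProduct, Fin.sum_univ_three, Matrix.cons_val_zero, Matrix.cons_val_one,
      Matrix.cons_val_two, Matrix.head_cons, Matrix.tail_cons]
    linear_combination (ω ^ 2 - (ω) + 1) * hω

/-- **`B₂` is inscribed and circumscribed to the triangle
`E_{−3ε²} = H_{ε²} = (X+ε²Y+Z)(X+εY+εZ)(X+Y+ε²Z)`** (Q2242 `hesse_omega_sq_eq_prod`): at its vertices
`(ε,1,1), (1,ε,1), (1,1,ε)` `B₂` vanishes and `∇B₂` is `(2ε+1)·(1,ε²,1)`, `(2ε+1)·(1,1,ε²)`,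
`(ε²+2)·(1,ε,ε)` — the sides `X+ε²Y+Z`, `X+Y+ε²Z`, `X+εY+εZ` through those vertices
(`ω² + ω + 1 = 0`).
[cite: ArtebaniDolgachev2009, §5, Prop. 5.2 ("inscribed and circumscribed to the other three
triangles (i.e. is tangent to one side of the triangle at each vertex)")] -/
theorem B₂_tangent_triangle_omega_sq {ω : K} (hω : ω ^ 2 + ω + 1 = 0) :
    (eval ![ω, (1 : K), 1] (𝐁₂ : MvPolynomial (Fin 3) K) = 0 ∧
        (fun i => eval ![ω, (1 : K), 1] (pderiv i (𝐁₂ : MvPolynomial (Fin 3) K))) = (2 * ω + 1 : K) • ![(1 : K), ω ^ 2, 1] ∧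
        ![(1 : K), ω ^ 2, 1] ⬝ᵥ ![ω, (1 : K), 1] = (0 : K)) ∧
      (eval ![(1 : K), ω, 1] (𝐁₂ : MvPolynomial (Fin 3) K) = 0 ∧
        (fun i => eval ![(1 : K), ω, 1] (pderiv i (𝐁₂ : MvPolynomial (Fin 3) K))) = (2 * ω + 1 : K) • ![(1 : K), 1, ω ^ 2] ∧
        ![(1 : K), 1, ω ^ 2] ⬝ᵥ ![(1 : K), ω, 1] = (0 : K)) ∧
      (eval ![(1 : K), 1, ω] (𝐁₂ : MvPolynomial (Fin 3) K) = 0 ∧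
        (fun i => eval ![(1 : K), 1, ω] (pderiv i (𝐁₂ : MvPolynomial (Fin 3) K))) = (ω ^ 2 + 2 : K) • ![(1 : K), ω, ω] ∧
        ![(1 : K), ω, ω] ⬝ᵥ ![(1 : K), 1, ω] = (0 : K)) := by
  refine ⟨⟨?_, ?_, ?_⟩, ⟨?_, ?_, ?_⟩, ⟨?_, ?_, ?_⟩⟩
  · rw [(B₂_eval _).1]
    simp only [Matrix.cons_val_zero, Matrix.cons_val_one, Matrix.cons_val_two, Matrix.head_cons,
      Matrix.tail_cons]
    linear_combination (1) * hω
  · rw [(B₂_eval _).2]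
    simp only [Matrix.smul_cons, Matrix.smul_empty, smul_eq_mul, Matrix.cons_val_zero, Matrix.cons_val_one,
      Matrix.cons_val_two, Matrix.head_cons, Matrix.tail_cons, vec3_eq_iff]
    exact ⟨by ring, by linear_combination (-2 * ω + 2) * hω, by ring⟩
  · simp only [dotProduct, Fin.sum_univ_three, Matrix.cons_val_zero, Matrix.cons_val_one,
      Matrix.cons_val_two, Matrix.head_cons, Matrix.tail_cons]
    linear_combination (1) * hω
  · rw [(B₂_eval _).1]
    simp only [Matrix.cons_val_zero, Matrix.cons_val_one, Matrix.cons_val_two, Matrix.head_cons,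
      Matrix.tail_cons]
    linear_combination (1) * hω
  · rw [(B₂_eval _).2]
    simp only [Matrix.smul_cons, Matrix.smul_empty, smul_eq_mul, Matrix.cons_val_zero, Matrix.cons_val_one,
      Matrix.cons_val_two, Matrix.head_cons, Matrix.tail_cons, vec3_eq_iff]
    exact ⟨by ring, by ring, by linear_combination (-2 * ω + 2) * hω⟩
  · simp only [dotProduct, Fin.sum_univ_three, Matrix.cons_val_zero, Matrix.cons_val_one,
      Matrix.cons_val_two, Matrix.head_cons, Matrix.tail_cons]
    linear_combination (1) * hω
  · rw [(B₂_eval _).1]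
    simp only [Matrix.cons_val_zero, Matrix.cons_val_one, Matrix.cons_val_two, Matrix.head_cons,
      Matrix.tail_cons]
    linear_combination (1) * hω
  · rw [(B₂_eval _).2]
    simp only [Matrix.smul_cons, Matrix.smul_empty, smul_eq_mul, Matrix.cons_val_zero, Matrix.cons_val_one,
      Matrix.cons_val_two, Matrix.head_cons, Matrix.tail_cons, vec3_eq_iff]
    exact ⟨by ring, by linear_combination (-(ω) + 1) * hω, by linear_combination (-(ω) + 1) * hω⟩
  · simp only [dotProduct, Fin.sum_univ_three, Matrix.cons_val_zero, Matrix.cons_val_one,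
      Matrix.cons_val_two, Matrix.head_cons, Matrix.tail_cons]
    linear_combination (1) * hω

/-- **`B₁ = X³ + εY³ + ε²Z³` is inscribed and circumscribed to the triangle
`E_{−3} = H_1 = (X+Y+Z)(X+εY+ε²Z)(X+ε²Y+εZ)`** (Q2242 `hesse_one_eq_prod`, vertices
`hesse_one_vertices`): at `(1,1,1), (1,ε,ε²), (1,ε²,ε)` it vanishes with `∇B₁ = 3·(1,ε,ε²)`,
`3·(1,1,1)`, `3·(1,ε²,ε)` — the sides `X+εY+ε²Z`, `X+Y+Z`, `X+ε²Y+εZ` through those vertices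
(`ω² + ω + 1 = 0`).
[cite: ArtebaniDolgachev2009, §5, Prop. 5.2 ("inscribed and circumscribed to the other three
triangles (i.e. is tangent to one side of the triangle at each vertex)")] -/
theorem B₁_tangent_triangle_one {ω : K} (hω : ω ^ 2 + ω + 1 = 0) :
    (eval ![(1 : K), 1, 1] (𝐁₁[ω] : MvPolynomial (Fin 3) K) = 0 ∧
        (fun i => eval ![(1 : K), 1, 1] (pderiv i (𝐁₁[ω] : MvPolynomial (Fin 3) K))) = (3 : K) • ![(1 : K), ω, ω ^ 2] ∧
        ![(1 : K), ω, ω ^ 2] ⬝ᵥ ![(1 : K), 1, 1] = (0 : K)) ∧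
      (eval ![(1 : K), ω, ω ^ 2] (𝐁₁[ω] : MvPolynomial (Fin 3) K) = 0 ∧
        (fun i => eval ![(1 : K), ω, ω ^ 2] (pderiv i (𝐁₁[ω] : MvPolynomial (Fin 3) K))) = (3 : K) • ![(1 : K), 1, 1] ∧
        ![(1 : K), 1, 1] ⬝ᵥ ![(1 : K), ω, ω ^ 2] = (0 : K)) ∧
      (eval ![(1 : K), ω ^ 2, ω] (𝐁₁[ω] : MvPolynomial (Fin 3) K) = 0 ∧
        (fun i => eval ![(1 : K), ω ^ 2, ω] (pderiv i (𝐁₁[ω] : MvPolynomial (Fin 3) K))) = (3 : K) • ![(1 : K), ω ^ 2, ω] ∧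
        ![(1 : K), ω ^ 2, ω] ⬝ᵥ ![(1 : K), ω ^ 2, ω] = (0 : K)) := by
  refine ⟨⟨?_, ?_, ?_⟩, ⟨?_, ?_, ?_⟩, ⟨?_, ?_, ?_⟩⟩
  · rw [(B₁_eval ω _).1]
    simp only [Matrix.cons_val_zero, Matrix.cons_val_one, Matrix.cons_val_two, Matrix.head_cons,
      Matrix.tail_cons]
    linear_combination (1) * hω
  · rw [(B₁_eval ω _).2]
    simp only [Matrix.smul_cons, Matrix.smul_empty, smul_eq_mul, Matrix.cons_val_zero, Matrix.cons_val_one,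
      Matrix.cons_val_two, Matrix.head_cons, Matrix.tail_cons, vec3_eq_iff]
    exact ⟨by ring, by ring, by ring⟩
  · simp only [dotProduct, Fin.sum_univ_three, Matrix.cons_val_zero, Matrix.cons_val_one,
      Matrix.cons_val_two, Matrix.head_cons, Matrix.tail_cons]
    linear_combination (1) * hω
  · rw [(B₁_eval ω _).1]
    simp only [Matrix.cons_val_zero, Matrix.cons_val_one, Matrix.cons_val_two, Matrix.head_cons,
      Matrix.tail_cons]
    linear_combination (ω ^ 6 - (ω ^ 5) + ω ^ 3 - (ω) + 1) * hω
  · rw [(B₁_eval ω _).2]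
    simp only [Matrix.smul_cons, Matrix.smul_empty, smul_eq_mul, Matrix.cons_val_zero, Matrix.cons_val_one,
      Matrix.cons_val_two, Matrix.head_cons, Matrix.tail_cons, vec3_eq_iff]
    exact ⟨by ring, by linear_combination (3 * ω - 3) * hω, by linear_combination (3 * ω ^ 4 - 3 * ω ^ 3 + 3 * ω - 3) * hω⟩
  · simp only [dotProduct, Fin.sum_univ_three, Matrix.cons_val_zero, Matrix.cons_val_one,
      Matrix.cons_val_two, Matrix.head_cons, Matrix.tail_cons]
    linear_combination (1) * hω
  · rw [(B₁_eval ω _).1]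
    simp only [Matrix.cons_val_zero, Matrix.cons_val_one, Matrix.cons_val_two, Matrix.head_cons,
      Matrix.tail_cons]
    linear_combination (ω ^ 5 - (ω ^ 4) + ω ^ 3 - (ω) + 1) * hω
  · rw [(B₁_eval ω _).2]
    simp only [Matrix.smul_cons, Matrix.smul_empty, smul_eq_mul, Matrix.cons_val_zero, Matrix.cons_val_one,
      Matrix.cons_val_two, Matrix.head_cons, Matrix.tail_cons, vec3_eq_iff]
    exact ⟨by ring, by linear_combination (3 * ω ^ 3 - 3 * ω ^ 2) * hω, by linear_combination (3 * ω ^ 2 - 3 * ω) * hω⟩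
  · simp only [dotProduct, Fin.sum_univ_three, Matrix.cons_val_zero, Matrix.cons_val_one,
      Matrix.cons_val_two, Matrix.head_cons, Matrix.tail_cons]
    linear_combination (ω ^ 2 - (ω) + 1) * hω

/-- **`B₁` is inscribed and circumscribed to `H_ε`**: at the vertices `(ε²,1,1), (1,ε²,1), (1,1,ε²)`
it vanishes with `∇B₁ = 3ε·(1,1,ε)`, `3·(1,ε²,ε²)`, `3·(1,ε,1)` — the sides `X+Y+εZ`, `X+ε²Y+ε²Z`,
`X+εY+Z` through those vertices (`ω² + ω + 1 = 0`).
[cite: ArtebaniDolgachev2009, §5, Prop. 5.2 ("inscribed and circumscribed to the other three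
triangles (i.e. is tangent to one side of the triangle at each vertex)")] -/
theorem B₁_tangent_triangle_omega {ω : K} (hω : ω ^ 2 + ω + 1 = 0) :
    (eval ![ω ^ 2, (1 : K), 1] (𝐁₁[ω] : MvPolynomial (Fin 3) K) = 0 ∧
        (fun i => eval ![ω ^ 2, (1 : K), 1] (pderiv i (𝐁₁[ω] : MvPolynomial (Fin 3) K))) = (3 * ω : K) • ![(1 : K), 1, ω] ∧
        ![(1 : K), 1, ω] ⬝ᵥ ![ω ^ 2, (1 : K), 1] = (0 : K)) ∧
      (eval ![(1 : K), ω ^ 2, 1] (𝐁₁[ω] : MvPolynomial (Fin 3) K) = 0 ∧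
        (fun i => eval ![(1 : K), ω ^ 2, 1] (pderiv i (𝐁₁[ω] : MvPolynomial (Fin 3) K))) = (3 : K) • ![(1 : K), ω ^ 2, ω ^ 2] ∧
        ![(1 : K), ω ^ 2, ω ^ 2] ⬝ᵥ ![(1 : K), ω ^ 2, 1] = (0 : K)) ∧
      (eval ![(1 : K), 1, ω ^ 2] (𝐁₁[ω] : MvPolynomial (Fin 3) K) = 0 ∧
        (fun i => eval ![(1 : K), 1, ω ^ 2] (pderiv i (𝐁₁[ω] : MvPolynomial (Fin 3) K))) = (3 : K) • ![(1 : K), ω, 1] ∧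
        ![(1 : K), ω, 1] ⬝ᵥ ![(1 : K), 1, ω ^ 2] = (0 : K)) := by
  refine ⟨⟨?_, ?_, ?_⟩, ⟨?_, ?_, ?_⟩, ⟨?_, ?_, ?_⟩⟩
  · rw [(B₁_eval ω _).1]
    simp only [Matrix.cons_val_zero, Matrix.cons_val_one, Matrix.cons_val_two, Matrix.head_cons,
      Matrix.tail_cons]
    linear_combination (ω ^ 4 - (ω ^ 3) + ω) * hω
  · rw [(B₁_eval ω _).2]
    simp only [Matrix.smul_cons, Matrix.smul_empty, smul_eq_mul, Matrix.cons_val_zero, Matrix.cons_val_one,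
      Matrix.cons_val_two, Matrix.head_cons, Matrix.tail_cons, vec3_eq_iff]
    exact ⟨by linear_combination (3 * ω ^ 2 - 3 * ω) * hω, by ring, by ring⟩
  · simp only [dotProduct, Fin.sum_univ_three, Matrix.cons_val_zero, Matrix.cons_val_one,
      Matrix.cons_val_two, Matrix.head_cons, Matrix.tail_cons]
    linear_combination (1) * hω
  · rw [(B₁_eval ω _).1]
    simp only [Matrix.cons_val_zero, Matrix.cons_val_one, Matrix.cons_val_two, Matrix.head_cons,
      Matrix.tail_cons]
    linear_combination (ω ^ 5 - (ω ^ 4) + ω ^ 2 - (ω) + 1) * hω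
  · rw [(B₁_eval ω _).2]
    simp only [Matrix.smul_cons, Matrix.smul_empty, smul_eq_mul, Matrix.cons_val_zero, Matrix.cons_val_one,
      Matrix.cons_val_two, Matrix.head_cons, Matrix.tail_cons, vec3_eq_iff]
    exact ⟨by ring, by linear_combination (3 * ω ^ 3 - 3 * ω ^ 2) * hω, by ring⟩
  · simp only [dotProduct, Fin.sum_univ_three, Matrix.cons_val_zero, Matrix.cons_val_one,
      Matrix.cons_val_two, Matrix.head_cons, Matrix.tail_cons]
    linear_combination (ω ^ 2 - (ω) + 1) * hω
  · rw [(B₁_eval ω _).1]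
    simp only [Matrix.cons_val_zero, Matrix.cons_val_one, Matrix.cons_val_two, Matrix.head_cons,
      Matrix.tail_cons]
    linear_combination (ω ^ 6 - (ω ^ 5) + ω ^ 3 - (ω ^ 2) + 1) * hω
  · rw [(B₁_eval ω _).2]
    simp only [Matrix.smul_cons, Matrix.smul_empty, smul_eq_mul, Matrix.cons_val_zero, Matrix.cons_val_one,
      Matrix.cons_val_two, Matrix.head_cons, Matrix.tail_cons, vec3_eq_iff]
    exact ⟨by ring, by ring, by linear_combination (3 * ω ^ 4 - 3 * ω ^ 3 + 3 * ω - 3) * hω⟩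
  · simp only [dotProduct, Fin.sum_univ_three, Matrix.cons_val_zero, Matrix.cons_val_one,
      Matrix.cons_val_two, Matrix.head_cons, Matrix.tail_cons]
    linear_combination (1) * hω

/-- **`B₁` is inscribed and circumscribed to `H_{ε²}`**: at the vertices `(ε,1,1), (1,ε,1), (1,1,ε)`
it vanishes with `∇B₁ = 3ε²·(1,ε²,1)`, `3·(1,1,ε²)`, `3·(1,ε,ε)` — the sides `X+ε²Y+Z`, `X+Y+ε²Z`,
`X+εY+εZ` through those vertices (`ω² + ω + 1 = 0`).
[cite: ArtebaniDolgachev2009, §5, Prop. 5.2 ("inscribed and circumscribed to the other three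
triangles (i.e. is tangent to one side of the triangle at each vertex)")] -/
theorem B₁_tangent_triangle_omega_sq {ω : K} (hω : ω ^ 2 + ω + 1 = 0) :
    (eval ![ω, (1 : K), 1] (𝐁₁[ω] : MvPolynomial (Fin 3) K) = 0 ∧
        (fun i => eval ![ω, (1 : K), 1] (pderiv i (𝐁₁[ω] : MvPolynomial (Fin 3) K))) = (3 * ω ^ 2 : K) • ![(1 : K), ω ^ 2, 1] ∧
        ![(1 : K), ω ^ 2, 1] ⬝ᵥ ![ω, (1 : K), 1] = (0 : K)) ∧
      (eval ![(1 : K), ω, 1] (𝐁₁[ω] : MvPolynomial (Fin 3) K) = 0 ∧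
        (fun i => eval ![(1 : K), ω, 1] (pderiv i (𝐁₁[ω] : MvPolynomial (Fin 3) K))) = (3 : K) • ![(1 : K), 1, ω ^ 2] ∧
        ![(1 : K), 1, ω ^ 2] ⬝ᵥ ![(1 : K), ω, 1] = (0 : K)) ∧
      (eval ![(1 : K), 1, ω] (𝐁₁[ω] : MvPolynomial (Fin 3) K) = 0 ∧
        (fun i => eval ![(1 : K), 1, ω] (pderiv i (𝐁₁[ω] : MvPolynomial (Fin 3) K))) = (3 : K) • ![(1 : K), ω, ω] ∧
        ![(1 : K), ω, ω] ⬝ᵥ ![(1 : K), 1, ω] = (0 : K)) := by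
  refine ⟨⟨?_, ?_, ?_⟩, ⟨?_, ?_, ?_⟩, ⟨?_, ?_, ?_⟩⟩
  · rw [(B₁_eval ω _).1]
    simp only [Matrix.cons_val_zero, Matrix.cons_val_one, Matrix.cons_val_two, Matrix.head_cons,
      Matrix.tail_cons]
    linear_combination (ω) * hω
  · rw [(B₁_eval ω _).2]
    simp only [Matrix.smul_cons, Matrix.smul_empty, smul_eq_mul, Matrix.cons_val_zero, Matrix.cons_val_one,
      Matrix.cons_val_two, Matrix.head_cons, Matrix.tail_cons, vec3_eq_iff]
    exact ⟨by ring, by linear_combination (-3 * ω ^ 2 + 3 * ω) * hω, by ring⟩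
  · simp only [dotProduct, Fin.sum_univ_three, Matrix.cons_val_zero, Matrix.cons_val_one,
      Matrix.cons_val_two, Matrix.head_cons, Matrix.tail_cons]
    linear_combination (1) * hω
  · rw [(B₁_eval ω _).1]
    simp only [Matrix.cons_val_zero, Matrix.cons_val_one, Matrix.cons_val_two, Matrix.head_cons,
      Matrix.tail_cons]
    linear_combination (ω ^ 2 - (ω) + 1) * hω
  · rw [(B₁_eval ω _).2]
    simp only [Matrix.smul_cons, Matrix.smul_empty, smul_eq_mul, Matrix.cons_val_zero, Matrix.cons_val_one,
      Matrix.cons_val_two, Matrix.head_cons, Matrix.tail_cons, vec3_eq_iff]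
    exact ⟨by ring, by linear_combination (3 * ω - 3) * hω, by ring⟩
  · simp only [dotProduct, Fin.sum_univ_three, Matrix.cons_val_zero, Matrix.cons_val_one,
      Matrix.cons_val_two, Matrix.head_cons, Matrix.tail_cons]
    linear_combination (1) * hω
  · rw [(B₁_eval ω _).1]
    simp only [Matrix.cons_val_zero, Matrix.cons_val_one, Matrix.cons_val_two, Matrix.head_cons,
      Matrix.tail_cons]
    linear_combination (ω ^ 3 - (ω ^ 2) + 1) * hω
  · rw [(B₁_eval ω _).2]
    simp only [Matrix.smul_cons, Matrix.smul_empty, smul_eq_mul, Matrix.cons_val_zero, Matrix.cons_val_one,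
      Matrix.cons_val_two, Matrix.head_cons, Matrix.tail_cons, vec3_eq_iff]
    exact ⟨by ring, by ring, by linear_combination (3 * ω ^ 2 - 3 * ω) * hω⟩
  · simp only [dotProduct, Fin.sum_univ_three, Matrix.cons_val_zero, Matrix.cons_val_one,
      Matrix.cons_val_two, Matrix.head_cons, Matrix.tail_cons]
    linear_combination (1) * hω

end EightCubics

end Literature.AlgebraicGeometry.PlaneCurves
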